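import Summits.BirchSwinnertonDyer.BirchSwinnertonDyer.Theorems.ResidualThetaTransportAtTwoRlfTwistedDescentChase
import Summits.BirchSwinnertonDyer.BirchSwinnertonDyer.Theorems.ThetaPartnerAtTwoSignedTransportAtTwoRlfLambdaOfPrint
import Summits.BirchSwinnertonDyer.BirchSwinnertonDyer.Theorems.ThetaPartnerAtTwoSignedTransportAtTwoSurj2OfPrint
import HarnessLib

/-!
# Item 23110 `ResidualLambdaFormulaNegDiscAtTwo` for ONE curve of ANY rank from Greenberg's TWISTED DESCENT data:
# `ψ_u(H¹(ℚ_Σ/ℚ_∞, E[2^∞])) = H¹(ℚ_Σ/ℚ_∞, E[2^∞])` ∧ LIFT⁺₂ ∧ TCAS♯ ⟹ the residual `λ`-formula at `2` (road T, assembly)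

Route `ResidualThetaTransportAtTwo` (RTT, crux r201, stmt-BirchSwinnertonDyer-23110) / `ThetaPartnerAtTwo` (TP2, aside r205).
Seat `prover-bsd-wall-tp2-p2x` g12 (`--supports stmt-BirchSwinnertonDyer-23110`). THEOREMS ONLY (no definition, no named fact,
no `sorry`). Assembly of p652574 (`…RlfTwistedSurjEngine`: SURJ♯ ⟸ TCAS♯ + TCOINV♯), `…RlfTwistedDescentChase` (TCOINV♯ ⟸ (ii) +
LIFT⁺₂; `ψ_u(Sel⁺_∞) = Sel⁺_∞`; DIV⁺@2), the currency dictionary of `…SignedTransportAtTwoSurj2OfPrint` (𝒫 ↔ inertia) and the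
one-curve count of rtt-w4's all-rank door `ResidualThetaLayer.rlf2_of_surj_of_plusDiv` (p644772; its 30-line body is re-run here
over the route-independent `…SignedTransportAtTwoRlfLambdaOfPrint`, so that this file imports no route file). The BY-NAME doors
(route decl ⟸ PRINT + the twisted-lifting package) are the leaf sequel `…RlfOfTwistedDescentDoor`.

* `rlf2_of_twistedDescent` — `E/ℚ` globally minimal, good supersingular at `2`, `a₂ = 0`, `Δ_E < 0`, bad places in the finite set
  `S₀` of odd places, cyclotomic `(κ, γ)`, a `+` dual datum `D` with `X⁺` f.g. `Λ`-torsion and `μ = 0`, and ONE odd `u` with: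
  (ii) `ψ_u(H) = H` for `H = H¹(ℚ_Σ/ℚ_∞, E[2^∞])` (generic in `u` from PRINT Prop. 4.12 + weak Leopoldt:
  `…RlfTwistedAmbientGeneric`), (LIFT⁺₂) the twisted lifting at the place above `2`, and (TCAS♯) the twisted Cassels♯ statement at
  `S₀` (for every admissible family of local generators `g_v`, `γ^{N_v} ∈ Gal(ℚ̄/ℚ_∞)·g_v|`, `N_v = 2^{v₂((ℓ_v²−1)/8)}`) — THEN
  `#R♯_{S₀}(E) = 2^{λ(X⁺) + Σ_{v ∈ S₀} N_v · d_v(E,2)}`, the conclusion of 23110 for this curve with `c = 0`.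

Road T thus reads, for ONE curve of any Mordell–Weil rank: 23110 ⟸ PRINT {Prop. 4.12, weak Leopoldt at `2`} (route PUB binders)
+ (LIFT⁺₂) + (TCAS♯) — both instances of Greenberg's «variant of Cassels' theorem for `A_s`» at level `ℚ` (Prop. 4.13 + Remark,
LNM 1716 pp. 122–123: Poitou–Tate for the finite twisted modules `E[2^J](χ_u)`, tree `ZpExtension.galoisTwist` /
`poitouTate_selmerStructure_duality`) plus the `Γ`-descent of local classes at `S₀` (`cd₂ ℤ₂ = 1`) and Kobayashi's `+` condition
at `2` (the signed local theory at `2`: cell t42's T2/δ2 shape for the `+` structure).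
HONEST FRAMING: (ii), (LIFT⁺₂), (TCAS♯) are displayed hypotheses (research inputs at `2`); closes nothing; BSD is not proved by any of
this. References: [GreenbergLNM1716] §4 Lemma 4.6, Props. 4.13–4.14 (pp. 105–108, 122–124); [GreenbergVatsal2000] §2 Prop. (2.1),
Cor. (2.3), (10); [BDKim2013] Thm. 1.1; [Matsuno2008] Lemma 4.3.
-/

set_option autoImplicit false
-- the Theorems namespace of this sub repeats the summit name by design (D-0017 nested layout)
set_option linter.dupNamespace false

noncomputable section

open scoped Classical NumberField AddSubgroup

open NumberField IsDedekindDomain Function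

namespace Summit.BirchSwinnertonDyer.BirchSwinnertonDyer.Theorems.SignedEC.TwistedSurj

open Literature.NumberTheory.EllipticCurves Literature.NumberTheory.GaloisRepresentations
  WeierstrassCurve ZpExtension Literature.NumberTheory.EllipticCurves.Kobayashi2003
  Literature.NumberTheory.EllipticCurves.GreenbergVatsal2000 Literature.NumberTheory.EllipticCurves.GreenbergSelmer
  Literature.NumberTheory.EllipticCurves.Rank1Residual
  Summit.BirchSwinnertonDyer.BirchSwinnertonDyer.Theorems.SignedTransportAtTwo

/-- **Item 23110 for one curve of any rank from the twisted-descent data** (see the module docstring for the statement and the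
chain). [cite: GreenbergLNM1716, §4 Lemma 4.6 (p. 107), Prop. 4.13 Remark (p. 123), Prop. 4.14 (pp. 123–124)]
[cite: GreenbergVatsal2000, §2 Prop. (2.1), Cor. (2.3), (10)] [cite: BDKim2013, Thm. 1.1] -/
theorem rlf2_of_twistedDescent (κ : ZpExtension ℚ 2) (γ : Field.absoluteGaloisGroup ℚ) (hκ : κ.IsCyclotomic)
    (hγ : κ.IsTopGenerator γ) (S₀ : Finset (HeightOneSpectrum (𝓞 ℚ))) (hS2 : ∀ v ∈ S₀, ((2 : ℕ) : 𝓞 ℚ) ∉ v.asIdeal)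
    (E : WeierstrassCurve ℚ) [E.IsElliptic] [E.IsGloballyMinimal] (hss : GoodSS E 2) (ha2 : E.frobeniusTrace 2 = 0)
    (hΔ : E.Δ < 0)
    (hS : ∀ v : HeightOneSpectrum (𝓞 ℚ), ¬ E.HasGoodReductionAt v → v ∈ S₀)
    (D : SignedSelmerDualData E κ γ 1) [Module.Finite (IwasawaAlgebra 2) D.X]
    (hT : Module.IsTorsion (IwasawaAlgebra 2) D.X) (hμ : D.mu = 0)
    {u : ℤ} (hu : (2 : ℤ) ∣ u - 1)
    (hH : ∀ h ∈ unramifiedOutside κ.kerSubgroup ↥(E.geomPrimaryTorsion 2) 2 (↑S₀ : Set (HeightOneSpectrum (𝓞 ℚ))),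
      ∃ h' ∈ unramifiedOutside κ.kerSubgroup ↥(E.geomPrimaryTorsion 2) 2 (↑S₀ : Set (HeightOneSpectrum (𝓞 ℚ))),
        u • E.conjH1 2 κ.kerSubgroup γ h' - h' = h)
    (hlift : ∀ c ∈ unramifiedOutside κ.kerSubgroup ↥(E.geomPrimaryTorsion 2) 2 (↑S₀ : Set (HeightOneSpectrum (𝓞 ℚ))),
      u • E.conjH1 2 κ.kerSubgroup γ c - c ∈
        ⨅ (v : HeightOneSpectrum (𝓞 ℚ)) (_ : ((2 : ℕ) : 𝓞 ℚ) ∈ v.asIdeal) (σ : Field.absoluteGaloisGroup ℚ),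
          (localKummerOverOfEmb E 2 κ.kerSubgroup (closureEmb (K := ℚ) (v.adicCompletion ℚ))
            (⨆ n : ℕ, signedLocalPoints κ (v.adicCompletion ℚ) E 1 n)).comap (E.conjH1 2 κ.kerSubgroup σ) →
      ∃ c' ∈ unramifiedOutside κ.kerSubgroup ↥(E.geomPrimaryTorsion 2) 2 (↑S₀ : Set (HeightOneSpectrum (𝓞 ℚ))),
        u • E.conjH1 2 κ.kerSubgroup γ c' = c' ∧ c - c' ∈
          ⨅ (v : HeightOneSpectrum (𝓞 ℚ)) (_ : ((2 : ℕ) : 𝓞 ℚ) ∈ v.asIdeal) (σ : Field.absoluteGaloisGroup ℚ),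
            (localKummerOverOfEmb E 2 κ.kerSubgroup (closureEmb (K := ℚ) (v.adicCompletion ℚ))
              (⨆ n : ℕ, signedLocalPoints κ (v.adicCompletion ℚ) E 1 n)).comap (E.conjH1 2 κ.kerSubgroup σ))
    (htwCas : ∀ g : (∀ v : HeightOneSpectrum (𝓞 ℚ), Field.absoluteGaloisGroup (v.adicCompletion ℚ)),
      (∀ v ∈ S₀, ∃ h ∈ κ.kerSubgroup, γ ^ 2 ^ padicValNat 2 ((Rat.HeightOneSpectrum.natGenerator v ^ 2 - 1) / 8) =
        h * resGal (K := ℚ) (v.adicCompletion ℚ) (g v)) →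
      ∀ z : (∀ v : HeightOneSpectrum (𝓞 ℚ),
          discreteH1 (localSubgroup κ.kerSubgroup (v.adicCompletion ℚ)) (localPoints E (v.adicCompletion ℚ))),
        (∀ v ∈ S₀, ∃ k : ℕ, 2 ^ k • z v = 0) →
        (∀ v ∈ S₀, u ^ 2 ^ padicValNat 2 ((Rat.HeightOneSpectrum.natGenerator v ^ 2 - 1) / 8) •
            Literature.NumberTheory.EllipticCurves.conjH1 (localSubgroup κ.kerSubgroup (v.adicCompletion ℚ))
              (localPoints E (v.adicCompletion ℚ)) (g v) (z v) = z v) →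
        ∃ c ∈ unramifiedOutside κ.kerSubgroup ↥(E.geomPrimaryTorsion 2) 2 (↑S₀ : Set (HeightOneSpectrum (𝓞 ℚ))) ⊓
            ⨅ (v : HeightOneSpectrum (𝓞 ℚ)) (_ : ((2 : ℕ) : 𝓞 ℚ) ∈ v.asIdeal) (σ : Field.absoluteGaloisGroup ℚ),
              (localKummerOverOfEmb E 2 κ.kerSubgroup (closureEmb (K := ℚ) (v.adicCompletion ℚ))
                (⨆ n : ℕ, signedLocalPoints κ (v.adicCompletion ℚ) E 1 n)).comap (E.conjH1 2 κ.kerSubgroup σ),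
          u • E.conjH1 2 κ.kerSubgroup γ c = c ∧
            ∀ v ∈ S₀, E.localResOver 2 κ.kerSubgroup (v.adicCompletion ℚ) c = z v) :
    {x : subgroupH1 κ.kerSubgroup ↥((↥(E.geomPrimaryTorsion 2))[(2 : ℤ)]) |
        x ∈ unramifiedOutside κ.kerSubgroup ↥((↥(E.geomPrimaryTorsion 2))[(2 : ℤ)]) 2
            (↑S₀ : Set (HeightOneSpectrum (𝓞 ℚ))) ∧
          (∀ (w : InfinitePlace ℚ) (σ : Field.absoluteGaloisGroup ℚ),
            Literature.NumberTheory.EllipticCurves.conjH1 κ.kerSubgroup ↥((↥(E.geomPrimaryTorsion 2))[(2 : ℤ)]) σ x ∈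
              GreenbergSelmer.infKer κ.kerSubgroup ↥((↥(E.geomPrimaryTorsion 2))[(2 : ℤ)]) w) ∧
          (∀ (v : HeightOneSpectrum (𝓞 ℚ)), ((2 : ℕ) : 𝓞 ℚ) ∈ v.asIdeal → ∀ σ : Field.absoluteGaloisGroup ℚ,
            E.conjH1 2 κ.kerSubgroup σ
                (pushH1 κ.kerSubgroup ((↥(E.geomPrimaryTorsion 2))[(2 : ℤ)]).subtype (SignedTransportAtTwo.subtype_torsionBy_smul E 2) x) ∈
              localKummerOverOfEmb E 2 κ.kerSubgroup (closureEmb (K := ℚ) (v.adicCompletion ℚ))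
                (⨆ n : ℕ, signedLocalPoints κ (v.adicCompletion ℚ) E 1 n))}.ncard =
      2 ^ (lambdaInvariant 2 D.X +
        ∑ v ∈ S₀, 2 ^ padicValNat 2 ((Rat.HeightOneSpectrum.natGenerator v ^ 2 - 1) / 8) * dMultiplicity E 2 v) := by
  haveI : κ.kerSubgroup.Normal := by rw [ZpExtension.kerSubgroup]; infer_instance
  let H := κ.kerSubgroup
  let A := E.geomPrimaryTorsion 2
  let N : HeightOneSpectrum (𝓞 ℚ) → ℕ := fun v ↦ 2 ^ padicValNat 2 ((Rat.HeightOneSpectrum.natGenerator v ^ 2 - 1) / 8)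
  -- (TCOINV♯) from (ii) + (LIFT⁺₂): Greenberg's chase
  have hTC := twistedCoinv_sharp_of_ambient E κ 1 γ (↑S₀ : Set (HeightOneSpectrum (𝓞 ℚ))) u hH hlift
  -- the local generators at the odd places (junk elsewhere), with `2^{s_v} = N_v`
  have hgen : ∀ v : HeightOneSpectrum (𝓞 ℚ), ∃ (g : Field.absoluteGaloisGroup (v.adicCompletion ℚ)),
      ((2 : ℕ) : 𝓞 ℚ) ∉ v.asIdeal →
      (∃ h ∈ κ.kerSubgroup, γ ^ N v = h * resGal (K := ℚ) (v.adicCompletion ℚ) g) ∧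
      (∀ c : discreteH1 (localSubgroup κ.kerSubgroup (v.adicCompletion ℚ)) (localPoints E (v.adicCompletion ℚ)),
        ∃ j : ℕ, Literature.NumberTheory.EllipticCurves.conjH1 (localSubgroup κ.kerSubgroup (v.adicCompletion ℚ))
          (localPoints E (v.adicCompletion ℚ)) (g ^ 2 ^ j) c = c) := by
    intro v
    by_cases hpv : ((2 : ℕ) : 𝓞 ℚ) ∈ v.asIdeal
    · exact ⟨1, fun h ↦ absurd hpv h⟩
    · obtain ⟨s, g, h1, h2, h3, h4, -⟩ := SignedEC.exists_localGenerator_two E κ hκ hγ v hpv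
      have hs : s = padicValNat 2 (Rat.HeightOneSpectrum.natGenerator v ^ 2 - 1) - 3 :=
        SignedEC.localGenerator_exponent_eq κ hκ v hpv h3 h2
      have hℓprime : (Rat.HeightOneSpectrum.natGenerator v).Prime := Rat.HeightOneSpectrum.prime_natGenerator v
      have hℓp : Rat.HeightOneSpectrum.natGenerator v ≠ 2 :=
        Summit.BirchSwinnertonDyer.Rank1Residual.X2.EulerFactorInvariants.natGenerator_ne_of_natCast_not_mem v hpv
      have hodd : Odd (Rat.HeightOneSpectrum.natGenerator v) := hℓprime.odd_of_ne_two hℓp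
      have h8 : padicValNat 2 ((Rat.HeightOneSpectrum.natGenerator v ^ 2 - 1) / 8) =
          padicValNat 2 (Rat.HeightOneSpectrum.natGenerator v ^ 2 - 1) - 3 := by
        rw [show (8 : ℕ) = 2 ^ 3 by norm_num,
          padicValNat.div_pow ((SignedTransportAtTwo.eight_dvd_sq_sub_one hodd).trans (by norm_num))]
      have hN : N v = 2 ^ s := by simp only [N, h8, hs]
      refine ⟨g, fun _ ↦ ⟨?_, h4⟩⟩
      rw [hN]; exact h1
  choose g hg using hgen
  have hgS : ∀ v ∈ S₀, ∃ h ∈ κ.kerSubgroup, γ ^ N v = h * resGal (K := ℚ) (v.adicCompletion ℚ) (g v) :=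
    fun v hv ↦ (hg v (hS2 v hv)).1
  have hgper : ∀ v ∈ S₀, ∀ c : discreteH1 (localSubgroup κ.kerSubgroup (v.adicCompletion ℚ)) (localPoints E (v.adicCompletion ℚ)),
      (∃ k : ℕ, 2 ^ k • c = 0) → ∃ j : ℕ,
        Literature.NumberTheory.EllipticCurves.conjH1 (localSubgroup κ.kerSubgroup (v.adicCompletion ℚ))
          (localPoints E (v.adicCompletion ℚ)) (g v ^ 2 ^ j) c = c := fun v hv c _ ↦ (hg v (hS2 v hv)).2 c
  have hTCas := htwCas g hgS
  -- SURJ♯ in the `𝒫`-currency (p652574)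
  have hsurjP := sharp_localRes_surjective_of_twistedCassels_of_twistedCoinv E κ 1 γ S₀ hu N (fun v _ ↦ ⟨_, rfl⟩) g hgS hgper
    hTCas hTC
  -- SURJ in the inertia currency (the dictionary of `…SignedTransportAtTwoSurj2OfPrint`)
  have hsurj : ∀ y : (Π i : ↥S₀, Fin (2 ^ padicValNat 2 ((Rat.HeightOneSpectrum.natGenerator i.1 ^ 2 - 1) / 8)) →
        discreteH1 ↥(GreenbergSelmer.inertiaIn κ.kerSubgroup i.1) ↥(E.geomPrimaryTorsion 2)),
      (∀ (i : ↥S₀) (n : Fin (2 ^ padicValNat 2 ((Rat.HeightOneSpectrum.natGenerator i.1 ^ 2 - 1) / 8))), y i n ∈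
        (resH1Hom (subgroupInclusion (GreenbergSelmer.inertiaIn_le_decompIn κ.kerSubgroup i.1))
          (AddMonoidHom.id ↥(E.geomPrimaryTorsion 2)) (fun _ _ ↦ rfl)).range) →
      ∃ c ∈ (unramifiedOutside κ.kerSubgroup ↥(E.geomPrimaryTorsion 2) 2 (↑S₀ : Set (HeightOneSpectrum (𝓞 ℚ))) ⊓
          ⨅ (v : HeightOneSpectrum (𝓞 ℚ)) (_ : ((2 : ℕ) : 𝓞 ℚ) ∈ v.asIdeal) (σ : Field.absoluteGaloisGroup ℚ),
            (localKummerOverOfEmb E 2 κ.kerSubgroup (closureEmb (K := ℚ) (v.adicCompletion ℚ))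
                (⨆ n : ℕ, signedLocalPoints κ (v.adicCompletion ℚ) E 1 n)).comap (E.conjH1 2 κ.kerSubgroup σ)),
        ∀ (i : ↥S₀) (n : Fin (2 ^ padicValNat 2 ((Rat.HeightOneSpectrum.natGenerator i.1 ^ 2 - 1) / 8))),
          resH1Hom (GreenbergSelmer.inertiaInToH κ.kerSubgroup i.1) (AddMonoidHom.id ↥(E.geomPrimaryTorsion 2)) (fun _ _ ↦ rfl)
            (Literature.NumberTheory.EllipticCurves.conjH1 κ.kerSubgroup ↥(E.geomPrimaryTorsion 2) (γ ^ (n : ℕ)) c) = y i n := by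
    intro y hy
    have hy' : ∀ (i : ↥S₀) (n : Fin (2 ^ padicValNat 2 ((Rat.HeightOneSpectrum.natGenerator i.1 ^ 2 - 1) / 8))),
        ∃ x : discreteH1 (decompIn H i.1) A,
          resH1Hom (subgroupInclusion (inertiaIn_le_decompIn H i.1)) (AddMonoidHom.id A) (fun _ _ ↦ rfl) x = y i n :=
      fun i n ↦ AddMonoidHom.mem_range.1 (hy i n)
    choose x hx using hy'
    have hβ := fun i : ↥S₀ ↦ SignedTransportAtTwo.exists_localCurrency_hom E κ i.1 (hS2 i.1 i.2)
    choose β hβinj hβcomp hβtor using hβ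
    let y' : ∀ v : HeightOneSpectrum (𝓞 ℚ), ℕ →
        discreteH1 (localSubgroup H (v.adicCompletion ℚ)) (localPoints E (v.adicCompletion ℚ)) := fun v n ↦
      if hv : v ∈ S₀ then (if hn : n < N v then β ⟨v, hv⟩ (x ⟨v, hv⟩ ⟨n, hn⟩) else 0) else 0
    have hy'def : ∀ (v : HeightOneSpectrum (𝓞 ℚ)) (hv : v ∈ S₀) (n : ℕ) (hn : n < N v),
        y' v n = β ⟨v, hv⟩ (x ⟨v, hv⟩ ⟨n, hn⟩) := fun v hv n hn ↦ by
      simp only [y', dif_pos hv, dif_pos hn]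
    have hy'tor : ∀ v ∈ S₀, ∀ n < N v, ∃ k : ℕ, 2 ^ k • y' v n = 0 := fun v hv n hn ↦ by
      rw [hy'def v hv n hn]
      exact hβtor ⟨v, hv⟩ _
    obtain ⟨c, hc, hcy⟩ := hsurjP y' hy'tor
    refine ⟨c, hc, fun i n ↦ ?_⟩
    have h1 := hcy i.1 i.2 (n : ℕ) n.2
    rw [hy'def i.1 i.2 (n : ℕ) n.2, ← hβcomp i] at h1
    have h2 := hβinj i h1
    rw [SignedTransportAtTwo.resH1Hom_inertiaInToH_eq_comp E H i.1, h2]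
    exact hx i n
  -- `ψ_u(Sel⁺_∞) = Sel⁺_∞` (descent through (TCAS♯)) and DIV⁺@2
  have hrep : ∀ v ∈ S₀, ∀ σ : Field.absoluteGaloisGroup ℚ, ∃ n < N v, ∃ δ ∈ decomp (K := ℚ) v,
      ∃ h ∈ κ.kerSubgroup, σ = h * (δ * γ ^ n) := fun v hv σ ↦
    SignedTransportAtTwo.forall_exists_lt_two' κ hκ hγ (hS2 v hv) σ
  have hco := twistedCoinv_signed_of_sharp E κ hκ hΔ γ S₀ hu N g hgS hrep hTCas hTC
  have hdiv := plusDiv2_of_twistedCoinv_int D hT hμ hu hco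
  -- the one-curve count (body of rtt-w4's `ResidualThetaLayer.rlf2_of_surj_of_plusDiv`, p644772, re-run route-independently)
  -- link 1: the residual group is the `2`-torsion of `Sel♯_{S₀}`
  rw [ncard_residualSharp_eq_natCard_imprimitive E hss hΔ κ S₀ hS]
  -- quotCard2: `#(Sel♯_{S₀}/Sel♯_∅)[2] = 2^{Σ N_v d_v}` from SURJ + the landed local count `stub_loc2`
  have hloc := natCard_torsionBy_sharp_quotient_eq_of_surj_of_loc E κ 1 S₀ hS2
    (fun v ↦ 2 ^ padicValNat 2 ((Rat.HeightOneSpectrum.natGenerator v ^ 2 - 1) / 8)) (fun v ↦ dMultiplicity E 2 v)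
    (fun v hv σ ↦ forall_exists_lt_two' κ hκ hγ (hS2 v hv) σ) hsurj (stub_loc2 κ γ hκ hγ S₀ hS2 E hss ha2 hΔ hS D hT hμ)
  rw [← signedSelmerInfty_eq_sharp_empty E κ hκ hΔ] at hloc
  -- sharpDiv2: `Sel♯_{S₀}` is `2`-divisible from SURJ + the landed local divisibility `stub_locDiv2` + DIV⁺
  have hdivT := sharp_divisible_of_surj_of_loc_of_empty E κ 1 S₀ hS2
    (fun v ↦ 2 ^ padicValNat 2 ((Rat.HeightOneSpectrum.natGenerator v ^ 2 - 1) / 8))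
    (fun v hv σ ↦ forall_exists_lt_two' κ hκ hγ (hS2 v hv) σ) hsurj (stub_locDiv2 κ γ hκ hγ S₀ hS2 E hss ha2 hΔ hS D hT hμ)
    (by
      intro s hs
      rw [← signedSelmerInfty_eq_sharp_empty E κ hκ hΔ] at hs ⊢
      obtain ⟨s', hs', h2⟩ := hdiv s hs
      exact ⟨s', hs', h2⟩)
  set S := signedSelmerInfty E κ 1 with hSdef
  set T := (unramifiedOutside κ.kerSubgroup ↥(E.geomPrimaryTorsion 2) 2 (↑S₀ : Set (HeightOneSpectrum (𝓞 ℚ))) ⊓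
      ⨅ (v : HeightOneSpectrum (𝓞 ℚ)) (_ : ((2 : ℕ) : 𝓞 ℚ) ∈ v.asIdeal) (σ : Field.absoluteGaloisGroup ℚ),
        (localKummerOverOfEmb E 2 κ.kerSubgroup (closureEmb (K := ℚ) (v.adicCompletion ℚ))
            (⨆ n : ℕ, signedLocalPoints κ (v.adicCompletion ℚ) E 1 n)).comap (E.conjH1 2 κ.kerSubgroup σ)) with hTdef
  -- `Sel⁺ ≤ Sel♯_{S₀}`
  have hle : S ≤ T := signedSelmerInfty_le_imprimitive E κ 1 (↑S₀ : Set (HeightOneSpectrum (𝓞 ℚ)))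
    (fun v hv ↦ Finset.mem_coe.mpr (hS v hv))
  -- finiteness of `Sel⁺[2]` and of `(Sel♯/Sel⁺)[2]`
  haveI : Finite (↥S)[((2 : ℕ) : ℤ)] := finite_torsionBy_signedSelmerInfty E κ γ 1 D hT hμ
  have hQ' : Nat.card ↥((↥T ⧸ S.addSubgroupOf T)[((2 : ℕ) : ℤ)]) =
      2 ^ (∑ v ∈ S₀, 2 ^ padicValNat 2 ((Rat.HeightOneSpectrum.natGenerator v ^ 2 - 1) / 8) * dMultiplicity E 2 v) := hloc
  haveI : Finite (↥T ⧸ S.addSubgroupOf T)[((2 : ℕ) : ℤ)] := Nat.finite_of_card_ne_zero (by rw [hQ']; positivity)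
  -- `Sel♯_{S₀}` is `2`-primary
  have hprim : ∀ t : T, ∃ n : ℕ, 2 ^ n • t = 0 := fun t ↦ by
    obtain ⟨k, hk⟩ := E.exists_pow_smul_subgroupH1_ker_eq_zero κ (t : E.subgroupH1 2 κ.kerSubgroup)
    exact ⟨k, Subtype.ext (by rw [AddSubgroupClass.coe_nsmul]; exact hk)⟩
  -- assemble the count
  have hcount : Nat.card ↥((↥T)[(2 : ℤ)]) = 2 ^ zpCorank S 2 * Nat.card ↥((↥T ⧸ S.addSubgroupOf T)[((2 : ℕ) : ℤ)]) :=
    natCard_torsionBy_eq_pow_zpCorank_mul 2 S T hle hprim hdivT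
  rw [hcount, zpCorank_signedSelmerInfty_eq_lambda E κ γ 1 D hT hμ, hQ', ← pow_add]
  rfl

end Summit.BirchSwinnertonDyer.BirchSwinnertonDyer.Theorems.SignedEC.TwistedSurj

end
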